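import Literature.Computability.Cryptography.ChenQuantumLWEDatumOptimum

/-!
# The datum read-out under ANY prior on the unknown coordinates: the exact value (T15)

REPRODUCTION / ANALYSIS OF A CLAIMED RESULT UNDER ADJUDICATION (withdrawn): Yilei Chen, *Quantum
Algorithms for Lattice Problems*, IACR ePrint 2024/555, version of 2024-04-18 [ChenQuantumLattice2024]
(the version carrying the author's note that Step 9 contains a bug), Step 9 (§3.5.9, pp. 34–38) acting
on `|φ8.b⟩ = Σ_{j ∈ ℤ_P} e(-j²/P) |2D²j·b + v′ mod N⟩` (p. 35), `P = p₁Q`, `N = D²P`.  Bundle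
`papers/QuantumAdvantage/lwe-quantum-autopsy/`, Part 2 (`REPAIR-CENSUS.md` §1 theorem **T15** and §24),
on top of `ChenQuantumLWEDatumOptimum.lean` (T13: the block-twisted kets `blockKet`, `datumKet_eq_blockKet`,
the routed POVM `POVM.ofRouting`, the value `datumValue`).
HONEST FRAMING: kernel-checked THEOREMS about a state occurring in a WITHDRAWN algorithm — here the EXACT
VALUE of an information quantity under an ARBITRARY PRIOR (how well ANY measurement of the register Step 9
receives can read the datum Step 9 consumes when the observer holds side information / a prior on the
unknown coordinates), i.e. a decidable verdict completing a precise NEGATIVE result; NOT summit progress,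
no cryptanalytic claim in either direction, no new algorithm for any lattice problem; quantum lower
bounds are out of scope.

## The question

T10–T14 average the class of one instance UNIFORMLY over the secret shift `s` (the unknown coordinates:
LWE-secret and noise entries, `U ∌ 0`), i.e. they are the exact optimum for an observer with NO prior on
the unknown coordinates.  In the LWE instances Chen's algorithm targets the unknown coordinates are SHORT
(discrete Gaussian of width `≈ β√2 ≪ Q`), so a referee may ask whether a prior-exploiting measurement can
beat `V(Q, m)`.  This file answers exactly, for EVERY prior.

## What is proved (every `Q`; `P` odd, Cond. C.3; `b ≡ bk` off `U`, `≡ 0 (mod p₁)` on `U`)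

Let `μ ≥ 0` be ANY weight on the secret shifts `s ∈ ℤ_Q^{n+1}` (only `s|_U` matters), the datum `a ∈ ℤ_Q`
and the offset shift `c` uniform (they ARE uniform and secret-independent in the algorithm — census §24).
With the twist shift `τ(β, s) = Σ_{i∈U}((b_i − bk_i)/p₁ + 2s_i)·β_i` of T13 and the PRIOR FIBRES
`F_μ(β, g) = Σ_{s : 2τ(β,s) = g} μ(s)` (`priorFiber`), the PRIOR VALUE is
`V_μ = (Σ_{β ∈ ℤ_Q^U} max_g F_μ(β, g)) / ((Σ_s μ(s))·Q^{#U})`  (`priorValue`)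
— the mean over a uniformly random PUBLIC `β` of the Bayes probability of predicting the single residue
`2τ(β, s) ∈ ℤ_Q`, a random linear form of the unknown coordinates.
* **Upper bound** (`datum_prior_success_prob_le_value`): for EVERY POVM on `ℤ_N^{n+1}` with outcomes in
  `ℤ_Q`, the `μ`-average probability of outputting the datum is `≤ V_μ`.  Mechanism: the offset average
  ALONE kills every entry off the residue blocks `ū = β` (`sum_offset_fourierGram_eq_zero` — first
  orthogonality with the secret FIXED), and on the block `β` the member `(a, s, ·)` IS the block-twisted
  ket `w_{β, a − 2τ(β,s)}` up to a phase (`datumKet_eq_blockKet`, T13); so the `μ`-weighted state given the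
  datum is DIAGONAL in the fixed orthogonal frame `(w_{β,r})` with eigenvalue `Q^{n+1}·F_μ(β, a − r)` on
  `w_{β,r}` (`prior_gram_eq`).  An abstract lemma (`POVM.sum_weight_le_of_gram_diag`: positivity and
  completeness) bounds any POVM by `Σ_{β,r} max_a λ_{a,(β,r)}·‖w_{β,r}‖²`.
* **Attainment** (`datumReadoutPrior`, `datumReadoutPrior_weight`, `datum_prior_success_prob_eq_value`):
  "read `ū = β`; discriminate the `Q` orthogonal twists on the block; output `r + ĝ(β)`" with the Bayes
  guess `ĝ(β) ∈ argmax_g F_μ(β, g)` is right on the member `(a,(s,c))` with Born weight exactly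
  `c·#{β : 2τ(β,s) = ĝ(β)}` and attains `V_μ` on average.
* Hence (`datum_prior_isGreatest`, `Shape.datum_privacy_prior`): `V_μ` is the EXACT optimum for every
  prior and every admissible shape.  Two extremes (`priorValue_one_eq_datumValue`, `priorValue_single`,
  `Shape.datum_privacy_prior_extremes`): no prior (`μ ≡ 1`) gives T13's `V(Q, #U)`; a KNOWN secret (point
  mass) gives `1`.  Always `V_μ ≤ 1` (`priorValue_le_one`).

Reading (census §24, rows G1/G2/G4/H1, §6 item (4)): whatever side information an observer has about the
unknown coordinates, ONE run's Step-9 register is worth EXACTLY one noiseless sample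
`(β, ⟨β, x_U⟩ mod Q)`, `β` uniform and public, `x_U = (b−bk)/p₁|_U + 2s|_U` the unknown-coordinate
vector — no more.  For the short (Gaussian) coordinates of an LWE instance the leftover-hash bound makes
this `1/Q + 2^{-Ω(m)}` (by hand, §24); the triage threshold for prior-exploiting repair proposals is `V_μ`,
not `V(Q, m)`; every census verdict stands.

## What is NOT here

The law of `(a, c)` given the transcript (uniform: by hand, census §24 Lemma A, from Steps 1–8); the
leftover-hash evaluation of `V_μ` for Gaussian priors (by hand + bundle numerics); several runs (the
sibling factors of T11/T14 are secret-independent, `ketGram_siblingKet`, so a common prior changes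
nothing there — by hand); the `q`-ary structure of the error-coordinate offsets (a computation on PUBLIC
data, outside the class model — §24 scope paragraph); any algorithm.

References: [ChenQuantumLattice2024] as above; [NielsenChuang2010] §2.2.6 p. 90 (POVMs), Box 2.3 p. 87
(state discrimination); [Korobov1992] Ch. I §3 (Gauss sums, via T3/T13).
-/

namespace Literature.Computability.Cryptography.Chen2024

open scoped BigOperators ComplexOrder
open Matrix

/-! ### 1. An abstract lemma: Gram matrices diagonal in a fixed family of kets -/

section Diag

variable {X I A J : Type*} [Fintype X] [DecidableEq X] [Fintype I] [Fintype A] [Fintype J]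

/-- Weighted form of `POVM.sum_weight_eq_gram`:
`Σ_i ω_i⟨ψ_i|E_a|ψ_i⟩ = Σ_{x,x′} E_a(x,x′)·Σ_i ω_i ψ_i(x′)·conj ψ_i(x)`. [cite: NielsenChuang2010, §2.4.1 p. 99] -/
theorem POVM.sum_mul_weight_eq (E : POVM X A) (ψ : I → X → ℂ) (ω : I → ℂ) (a : A) :
    ∑ i, ω i * E.weight (ψ i) a
      = ∑ x, ∑ x', E.effect a x x' * ∑ i, ω i * (ψ i x' * (starRingEnd ℂ) (ψ i x)) := by
  simp_rw [POVM.weight_eq_sum, Finset.mul_sum]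
  rw [Finset.sum_comm]
  refine Finset.sum_congr rfl fun x _ => ?_
  rw [Finset.sum_comm]
  refine Finset.sum_congr rfl fun x' _ => ?_
  refine Finset.sum_congr rfl fun i _ => ?_
  ring

/-- **Diagonal lemma (state discrimination against a fixed frame).**  Let the weighted Gram matrices
`ρ_a = Σ_i ω_{a,i}|q_{a,i}⟩⟨q_{a,i}|` all be DIAGONAL in one fixed family of kets `(w_j)`:
`ρ_a = Σ_j λ_{a,j}|w_j⟩⟨w_j|` with `λ_{a,j} ≤ Λ_j`.  Then for every POVM `E` with outcomes in `A`:
`Σ_a tr(E_a ρ_a) ≤ Σ_j Λ_j‖w_j‖²` — `tr(E_a ρ_a) = Σ_j λ_{a,j}⟨w_j|E_a|w_j⟩ ≤ Σ_j Λ_j⟨w_j|E_a|w_j⟩` by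
positivity, and `Σ_a E_a = 1`.  (No orthogonality of the `w_j` is needed.)
[cite: NielsenChuang2010, §2.2.6 p. 90, Box 2.3 p. 87] -/
theorem POVM.sum_weight_le_of_gram_diag (E : POVM X A) (q : A → I → X → ℂ) (ω : A → I → ℝ)
    (w : J → X → ℂ) (lam : A → J → ℝ) (Λ : J → ℝ) (hle : ∀ a j, lam a j ≤ Λ j)
    (hgram : ∀ a x x', ∑ i, (ω a i : ℂ) * (q a i x * (starRingEnd ℂ) (q a i x'))
        = ∑ j, (lam a j : ℂ) * (w j x * (starRingEnd ℂ) (w j x'))) :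
    (∑ a, ∑ i, (ω a i : ℂ) * E.weight (q a i) a).re ≤ ∑ j, Λ j * (star (w j) ⬝ᵥ w j).re := by
  have hstep : ∀ a, ∑ i, (ω a i : ℂ) * E.weight (q a i) a = ∑ j, (lam a j : ℂ) * E.weight (w j) a := by
    intro a
    rw [POVM.sum_mul_weight_eq, POVM.sum_mul_weight_eq]
    refine Finset.sum_congr rfl fun x _ => Finset.sum_congr rfl fun x' _ => ?_
    rw [hgram a x' x]
  have hre : ∀ (ψ : X → ℂ) (a : A), 0 ≤ (E.weight ψ a).re := by
    intro ψ a
    have h := (Complex.le_def.1 (E.weight_nonneg ψ a)).1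
    simpa using h
  calc (∑ a, ∑ i, (ω a i : ℂ) * E.weight (q a i) a).re
      = ∑ a, ∑ j, lam a j * (E.weight (w j) a).re := by
        rw [Complex.re_sum]
        refine Finset.sum_congr rfl fun a _ => ?_
        rw [hstep a, Complex.re_sum]
        refine Finset.sum_congr rfl fun j _ => ?_
        rw [Complex.re_ofReal_mul]
    _ ≤ ∑ a, ∑ j, Λ j * (E.weight (w j) a).re :=
        Finset.sum_le_sum fun a _ => Finset.sum_le_sum fun j _ =>
          mul_le_mul_of_nonneg_right (hle a j) (hre (w j) a)
    _ = ∑ j, Λ j * ∑ a, (E.weight (w j) a).re := by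
        rw [Finset.sum_comm]
        refine Finset.sum_congr rfl fun j _ => ?_
        rw [Finset.mul_sum]
    _ = ∑ j, Λ j * (star (w j) ⬝ᵥ w j).re := by
        refine Finset.sum_congr rfl fun j _ => ?_
        rw [← Complex.re_sum, E.sum_weight]

end Diag

/-! ### 2. The class of one instance with the secret shift WEIGHTED by a prior -/

section Prior

variable (n : ℕ) (D p₁ Q : ℕ+)

/-- A member's Gram entry is a `fourierGram` entry (definitional). [folklore] -/
theorem datumKet_mul_conj (U : Finset (Fin (n + 1))) (bk b v' : Fin (n + 1) → ℤ) (a : ZQ Q)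
    (sc : (Fin (n + 1) → ZQ Q) × (Fin (n + 1) → ZQ Q)) (u u' : Fin (n + 1) → ZN D p₁ Q) :
    datumKet n D p₁ Q U bk b v' a sc u * (starRingEnd ℂ) (datumKet n D p₁ Q U bk b v' a sc u')
      = fourierGram n D p₁ Q (b + secretShift n p₁ Q U sc.1) (v' + classShift n D p₁ Q U bk a sc.2) u u' :=
  rfl

/-- **First orthogonality with the secret FIXED** (the offset average of ONE secret's member):
`Σ_c ρ̂_{b+2p₁s𝟙_U, v′+d(a,c)}(u,u′) = ψ_Q(a·λ(u′−u))·Π_i Q·[classFreq_i(u′−u) = 0]·ρ̂_{b+2p₁s𝟙_U, v′}(u,u′)`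
(`datumGram_eq_mul_sum` before the secret sum). [folklore] -/
theorem sum_offset_fourierGram (U : Finset (Fin (n + 1))) (bk b v' : Fin (n + 1) → ℤ) (a : ZQ Q)
    (s : Fin (n + 1) → ZQ Q) (u u' : Fin (n + 1) → ZN D p₁ Q) :
    ∑ c : Fin (n + 1) → ZQ Q,
        fourierGram n D p₁ Q (b + secretShift n p₁ Q U s) (v' + classShift n D p₁ Q U bk a c) u u'
      = (ZMod.stdAddChar (a * toQ p₁ Q (lineFun n D p₁ Q bk (u' - u)))
          * ∏ i, (if classFreq n D p₁ Q U (u' - u) i = 0 then ((((Q : ℕ+) : ℕ) : ℂ)) else 0))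
        * fourierGram n D p₁ Q (b + secretShift n p₁ Q U s) v' u u' := by
  simp_rw [fourierGram_shift]
  rw [← Finset.sum_mul, tailFactor_eq]

/-- Off the residue blocks the offset average of every single member vanishes:
`resid u ≠ resid u′ ⇒ Σ_c ρ̂_{b+2p₁s𝟙_U, v′+d(a,c)}(u,u′) = 0`. [folklore] -/
theorem sum_offset_fourierGram_eq_zero (U : Finset (Fin (n + 1))) (bk b v' : Fin (n + 1) → ℤ) (a : ZQ Q)
    (s : Fin (n + 1) → ZQ Q) {u u' : Fin (n + 1) → ZN D p₁ Q}
    (h : resid n D p₁ Q U u ≠ resid n D p₁ Q U u') :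
    ∑ c : Fin (n + 1) → ZQ Q,
        fourierGram n D p₁ Q (b + secretShift n p₁ Q U s) (v' + classShift n D p₁ Q U bk a c) u u' = 0 := by
  obtain ⟨i, -, hi⟩ := exists_classFreq_ne_of_resid_ne n D p₁ Q U h
  rw [sum_offset_fourierGram, Finset.prod_eq_zero (Finset.mem_univ i) (if_neg hi), mul_zero, zero_mul]

/-- On a residue block the offset average of the member `(a, s)` is `Q^{n+1}` times the projector entry of
ONE block-twisted ket, `w_{β, a − 2τ(β,s)}` (`datumKet_eq_blockKet`; the block phase cancels).
[cite: ChenQuantumLattice2024, §3.5.9 pp. 35–37, eq. (12) p. 17] -/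
theorem sum_offset_datumKet_mul_conj (U : Finset (Fin (n + 1))) (bk b v' : Fin (n + 1) → ℤ)
    (hb : ∀ i ∈ U, ((p₁ : ℕ) : ℤ) ∣ b i) (hbkU : ∀ i ∈ U, ((p₁ : ℕ) : ℤ) ∣ bk i)
    (hbk : ∀ i, i ∉ U → bk i = b i) (a : ZQ Q) (s : Fin (n + 1) → ZQ Q)
    {u u' : Fin (n + 1) → ZN D p₁ Q} (h : resid n D p₁ Q U u = resid n D p₁ Q U u') :
    ∑ c : Fin (n + 1) → ZQ Q,
        datumKet n D p₁ Q U bk b v' a (s, c) u * (starRingEnd ℂ) (datumKet n D p₁ Q U bk b v' a (s, c) u')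
      = ((((Q : ℕ+) : ℕ) : ℂ)) ^ (n + 1)
        * (blockKet n D p₁ Q U bk v'
              (resid n D p₁ Q U u, a - 2 * twistShift n p₁ Q U bk b (resid n D p₁ Q U u) s) u
            * (starRingEnd ℂ) (blockKet n D p₁ Q U bk v'
              (resid n D p₁ Q U u, a - 2 * twistShift n p₁ Q U bk b (resid n D p₁ Q U u) s) u')) := by
  have hterm : ∀ c : Fin (n + 1) → ZQ Q,
      datumKet n D p₁ Q U bk b v' a (s, c) u * (starRingEnd ℂ) (datumKet n D p₁ Q U bk b v' a (s, c) u')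
        = blockKet n D p₁ Q U bk v'
              (resid n D p₁ Q U u, a - 2 * twistShift n p₁ Q U bk b (resid n D p₁ Q U u) s) u
            * (starRingEnd ℂ) (blockKet n D p₁ Q U bk v'
              (resid n D p₁ Q U u, a - 2 * twistShift n p₁ Q U bk b (resid n D p₁ Q U u) s) u') := by
    intro c
    rw [datumKet_eq_blockKet n D p₁ Q U bk b v' hb hbkU hbk a (s, c) u,
      datumKet_eq_blockKet n D p₁ Q U bk b v' hb hbkU hbk a (s, c) u', ← h, map_mul]
    dsimp only
    have h1 := starRingEnd_stdAddChar_mul_self Q (blockPhase n p₁ Q U bk b (resid n D p₁ Q U u) (s, c))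
    linear_combination
      (blockKet n D p₁ Q U bk v' (resid n D p₁ Q U u, a - 2 * twistShift n p₁ Q U bk b (resid n D p₁ Q U u) s) u
        * (starRingEnd ℂ) (blockKet n D p₁ Q U bk v'
            (resid n D p₁ Q U u, a - 2 * twistShift n p₁ Q U bk b (resid n D p₁ Q U u) s) u')) * h1
  simp_rw [hterm]
  rw [Finset.sum_const, Finset.card_univ, Fintype.card_fun, ZMod.card, Fintype.card_fin, nsmul_eq_mul,
    Nat.cast_pow]

/-- The PRIOR FIBRES: the `μ`-mass of the secret shifts whose twist shift on the block `β` is `g`,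
`F_μ(β, g) = Σ_{s : 2τ(β,s) = g} μ(s)`. [folklore] -/
def priorFiber (U : Finset (Fin (n + 1))) (bk b : Fin (n + 1) → ℤ) (μ : (Fin (n + 1) → ZQ Q) → ℝ)
    (β : U → ZQ Q) (g : ZQ Q) : ℝ :=
  ∑ s ∈ Finset.univ.filter (fun s => 2 * twistShift n p₁ Q U bk b β s = g), μ s

/-- **The prior-weighted state given the datum is diagonal in the block-twisted frame.**  For ANY weight
`μ` on the secret shifts: `Σ_{s,c} μ(s)·|member(a,s,c)⟩⟨member(a,s,c)| = Q^{n+1}·Σ_{β,r} F_μ(β, a − r)·|w_{β,r}⟩⟨w_{β,r}|`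
entrywise — off the blocks by the offset average, on the block `β` because the member `(a,s,·)` IS the
twisted ket `w_{β, a − 2τ(β,s)}`. [cite: ChenQuantumLattice2024, §3.5.9 pp. 35–37, eq. (12) p. 17] -/
theorem prior_gram_eq (U : Finset (Fin (n + 1))) (bk b v' : Fin (n + 1) → ℤ)
    (hb : ∀ i ∈ U, ((p₁ : ℕ) : ℤ) ∣ b i) (hbkU : ∀ i ∈ U, ((p₁ : ℕ) : ℤ) ∣ bk i)
    (hbk : ∀ i, i ∉ U → bk i = b i) (μ : (Fin (n + 1) → ZQ Q) → ℝ) (a : ZQ Q)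
    (u u' : Fin (n + 1) → ZN D p₁ Q) :
    ∑ sc : (Fin (n + 1) → ZQ Q) × (Fin (n + 1) → ZQ Q), (μ sc.1 : ℂ)
        * (datumKet n D p₁ Q U bk b v' a sc u * (starRingEnd ℂ) (datumKet n D p₁ Q U bk b v' a sc u'))
      = ∑ j : (U → ZQ Q) × ZQ Q,
          ((((((Q : ℕ+) : ℕ) : ℝ)) ^ (n + 1) * priorFiber n p₁ Q U bk b μ j.1 (a - j.2) : ℝ) : ℂ)
            * (blockKet n D p₁ Q U bk v' j u * (starRingEnd ℂ) (blockKet n D p₁ Q U bk v' j u')) := by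
  classical
  rw [Fintype.sum_prod_type]
  simp_rw [← Finset.mul_sum]
  by_cases h : resid n D p₁ Q U u = resid n D p₁ Q U u'
  · -- on the block `β = resid u = resid u'`
    set β := resid n D p₁ Q U u with hβ
    simp_rw [sum_offset_datumKet_mul_conj n D p₁ Q U bk b v' hb hbkU hbk a _ h]
    -- the right-hand side lives on `j.1 = β`
    set X : ZQ Q → ℂ := fun r => blockKet n D p₁ Q U bk v' (β, r) u
        * (starRingEnd ℂ) (blockKet n D p₁ Q U bk v' (β, r) u') with hX
    have hrhs : ∑ j : (U → ZQ Q) × ZQ Q,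
          ((((((Q : ℕ+) : ℕ) : ℝ)) ^ (n + 1) * priorFiber n p₁ Q U bk b μ j.1 (a - j.2) : ℝ) : ℂ)
            * (blockKet n D p₁ Q U bk v' j u * (starRingEnd ℂ) (blockKet n D p₁ Q U bk v' j u'))
        = ∑ r : ZQ Q, ((((((Q : ℕ+) : ℕ) : ℝ)) ^ (n + 1) * priorFiber n p₁ Q U bk b μ β (a - r) : ℝ) : ℂ)
            * X r := by
      rw [Fintype.sum_prod_type, Finset.sum_eq_single β]
      · intro β' _ hβ'
        refine Finset.sum_eq_zero fun r _ => ?_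
        have h0 : blockKet n D p₁ Q U bk v' (β', r) u = 0 := by
          unfold blockKet
          rw [if_neg (fun h' => hβ' (h'.symm.trans rfl))]
        rw [h0, zero_mul, mul_zero]
      · exact fun h' => absurd (Finset.mem_univ β) h'
    rw [hrhs]
    -- unfold the fibres and resum over `s`
    have hfib : ∀ r : ZQ Q,
        ((((((Q : ℕ+) : ℕ) : ℝ)) ^ (n + 1) * priorFiber n p₁ Q U bk b μ β (a - r) : ℝ) : ℂ) * X r
          = ∑ s : Fin (n + 1) → ZQ Q, if a - 2 * twistShift n p₁ Q U bk b β s = r then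
              (μ s : ℂ) * (((((Q : ℕ+) : ℕ) : ℂ)) ^ (n + 1) * X (a - 2 * twistShift n p₁ Q U bk b β s))
              else 0 := by
      intro r
      unfold priorFiber
      rw [Finset.sum_filter, Complex.ofReal_mul, Complex.ofReal_sum, Finset.mul_sum, Finset.sum_mul]
      refine Finset.sum_congr rfl fun s _ => ?_
      by_cases hs : 2 * twistShift n p₁ Q U bk b β s = a - r
      · have hs' : a - 2 * twistShift n p₁ Q U bk b β s = r := by rw [hs]; ring
        rw [if_pos hs, if_pos hs', hs']
        push_cast
        ring
      · have hs' : ¬ a - 2 * twistShift n p₁ Q U bk b β s = r := by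
          intro h'; exact hs (by rw [← h']; ring)
        rw [if_neg hs, if_neg hs', Complex.ofReal_zero, mul_zero, zero_mul]
    simp_rw [hfib]
    rw [Finset.sum_comm]
    refine Finset.sum_congr rfl fun s _ => ?_
    rw [Finset.sum_ite_eq, if_pos (Finset.mem_univ _)]
  · -- off the blocks both sides vanish
    have hl : ∀ s : Fin (n + 1) → ZQ Q, ∑ c : Fin (n + 1) → ZQ Q,
        datumKet n D p₁ Q U bk b v' a (s, c) u * (starRingEnd ℂ) (datumKet n D p₁ Q U bk b v' a (s, c) u')
          = 0 := by
      intro s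
      simp_rw [datumKet_mul_conj]
      exact sum_offset_fourierGram_eq_zero n D p₁ Q U bk b v' a s h
    simp_rw [hl, mul_zero, Finset.sum_const_zero]
    symm
    refine Finset.sum_eq_zero fun j _ => ?_
    have h0 : blockKet n D p₁ Q U bk v' j u * (starRingEnd ℂ) (blockKet n D p₁ Q U bk v' j u') = 0 := by
      unfold blockKet
      by_cases hj : resid n D p₁ Q U u = j.1
      · have hj' : ¬ resid n D p₁ Q U u' = j.1 := fun h' => h (hj.trans h'.symm)
        rw [if_pos hj, if_neg hj', map_zero, mul_zero]
      · rw [if_neg hj, zero_mul]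
    rw [h0, mul_zero]

end Prior

/-! ### 3. The upper bound for every POVM and every prior -/

section Readout

variable (n : ℕ) (D p₁ Q : ℕ+)

/-- `c·Q^{#U} = P·N^{n+1}` (`card_resid_mul`). [folklore] -/
theorem blockConst_mul_pow (U : Finset (Fin (n + 1))) :
    blockConst n D p₁ Q U * (((Q : ℕ+) : ℕ) : ℝ) ^ U.card
      = (((p₁ * Q : ℕ+) : ℕ) : ℝ) * (((D * D * (p₁ * Q) : ℕ+) : ℕ) : ℝ) ^ (n + 1) := by
  have h := card_resid_mul n D p₁ Q U 0
  have h' : ((Nat.card {u : Fin (n + 1) → ZN D p₁ Q // resid n D p₁ Q U u = 0} : ℕ) : ℝ)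
      * ((((Q : ℕ+) : ℕ) : ℝ)) ^ U.card = ((((D * D * (p₁ * Q) : ℕ+) : ℕ) : ℝ)) ^ (n + 1) := by
    exact_mod_cast h
  unfold blockConst
  rw [mul_assoc, h']

/-- **T15 (upper bound, every POVM, every prior).**  For odd `P`, `b ≡ bk` off `U`, `b ≡ bk ≡ 0 (mod p₁)`
on `U`, a unit coordinate of `bk` off `U`, and ANY weight `μ` on the secret shifts with block-fibre bound
`F_μ(β, g) ≤ M(β)`: every POVM's `μ`-weighted total Born weight on "output = datum" (datum and offset shift
summed uniformly) is at most `Q^{n+2}·c·Σ_β M(β)`.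
[cite: ChenQuantumLattice2024, §3.5.9 pp. 35–37, eq. (12) p. 17; NielsenChuang2010, §2.2.6 p. 90] -/
theorem datum_prior_weight_le (hP : Odd ((p₁ * Q : ℕ+) : ℕ)) (U : Finset (Fin (n + 1)))
    (bk b v' : Fin (n + 1) → ℤ)
    (hb : ∀ i ∈ U, ((p₁ : ℕ) : ℤ) ∣ b i) (hbkU : ∀ i ∈ U, ((p₁ : ℕ) : ℤ) ∣ bk i)
    (hbk : ∀ i, i ∉ U → bk i = b i) (hunit : ∃ i₀, i₀ ∉ U ∧ IsUnit ((bk i₀ : ℤ) : ZQ Q))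
    (μ : (Fin (n + 1) → ZQ Q) → ℝ) (M : (U → ZQ Q) → ℝ)
    (hM : ∀ β g, priorFiber n p₁ Q U bk b μ β g ≤ M β)
    (E : POVM (Fin (n + 1) → ZN D p₁ Q) (ZQ Q)) :
    (∑ a, ∑ sc, (μ sc.1 : ℂ) * E.weight (datumKet n D p₁ Q U bk b v' a sc) a).re
      ≤ (((Q : ℕ+) : ℕ) : ℝ) ^ (n + 1) * (((Q : ℕ+) : ℕ) : ℝ) * blockConst n D p₁ Q U * ∑ β, M β := by
  classical
  have hQ : (0 : ℝ) ≤ (((Q : ℕ+) : ℕ) : ℝ) ^ (n + 1) := by positivity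
  have h := POVM.sum_weight_le_of_gram_diag E (fun a sc => datumKet n D p₁ Q U bk b v' a sc)
    (fun _ sc => μ sc.1) (blockKet n D p₁ Q U bk v')
    (fun a j => (((Q : ℕ+) : ℕ) : ℝ) ^ (n + 1) * priorFiber n p₁ Q U bk b μ j.1 (a - j.2))
    (fun j => (((Q : ℕ+) : ℕ) : ℝ) ^ (n + 1) * M j.1)
    (fun a j => mul_le_mul_of_nonneg_left (hM j.1 (a - j.2)) hQ)
    (fun a x x' => prior_gram_eq n D p₁ Q U bk b v' hb hbkU hbk μ a x x')
  refine h.trans (le_of_eq ?_)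
  have hnorm : ∀ j : (U → ZQ Q) × ZQ Q,
      (star (blockKet n D p₁ Q U bk v' j) ⬝ᵥ blockKet n D p₁ Q U bk v' j).re = blockConst n D p₁ Q U := by
    intro j
    rw [blockKet_orth n D p₁ Q hP U bk v' hunit, if_pos rfl, Complex.ofReal_re]
  simp_rw [hnorm]
  rw [Fintype.sum_prod_type, Finset.mul_sum]
  refine Finset.sum_congr rfl fun β _ => ?_
  dsimp only
  rw [Finset.sum_const, Finset.card_univ, ZMod.card, nsmul_eq_mul]
  ring

/-- The `μ`-weighted total weight of the class: `Q·Q^{n+1}·(Σ_s μ(s))·P·N^{n+1}`.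
[cite: ChenQuantumLattice2024, §3.5.9 p. 35] -/
theorem datum_prior_totalWeight (hP : Odd ((p₁ * Q : ℕ+) : ℕ)) (U : Finset (Fin (n + 1)))
    (bk b v' : Fin (n + 1) → ℤ) (μ : (Fin (n + 1) → ZQ Q) → ℝ) :
    (∑ a : ZQ Q, ∑ sc : (Fin (n + 1) → ZQ Q) × (Fin (n + 1) → ZQ Q),
        (μ sc.1 : ℂ) * (star (datumKet n D p₁ Q U bk b v' a sc) ⬝ᵥ datumKet n D p₁ Q U bk b v' a sc)).re
      = (((Q : ℕ+) : ℕ) : ℝ) * (((Q : ℕ+) : ℕ) : ℝ) ^ (n + 1) * (∑ s, μ s)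
        * ((((p₁ * Q : ℕ+) : ℕ) : ℝ) * (((D * D * (p₁ * Q) : ℕ+) : ℕ) : ℝ) ^ (n + 1)) := by
  have hC : ∀ (a : ZQ Q) (sc : (Fin (n + 1) → ZQ Q) × (Fin (n + 1) → ZQ Q)),
      (μ sc.1 : ℂ) * (star (datumKet n D p₁ Q U bk b v' a sc) ⬝ᵥ datumKet n D p₁ Q U bk b v' a sc)
        = ((μ sc.1 * ((((p₁ * Q : ℕ+) : ℕ) : ℝ) * (((D * D * (p₁ * Q) : ℕ+) : ℕ) : ℝ) ^ (n + 1)) : ℝ) : ℂ) := by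
    intro a sc
    rw [datumKet_normSq n D p₁ Q hP]
    push_cast
    ring
  simp_rw [hC, ← Complex.ofReal_sum]
  rw [Complex.ofReal_re, Finset.sum_const, Finset.card_univ, ZMod.card, nsmul_eq_mul, Fintype.sum_prod_type]
  dsimp only
  simp only [Finset.sum_const, Finset.card_univ, Fintype.card_fun, ZMod.card, Fintype.card_fin, nsmul_eq_mul]
  simp only [Finset.mul_sum, Finset.sum_mul]
  refine Finset.sum_congr rfl fun s _ => ?_
  push_cast
  ring

/-- **The PRIOR VALUE** of the datum: `V_μ = (Σ_β max_g F_μ(β, g)) / ((Σ_s μ(s))·Q^{#U})` — the mean over a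
uniformly random block `β ∈ ℤ_Q^U` of the largest `μ`-probability of a value of the twist shift `2τ(β, s)`,
i.e. the Bayes value of predicting ONE noiseless inner product `2τ(β,s) = Σ_{i∈U}((b_i−bk_i)/p₁ + 2s_i)β_i`
of the unknown coordinates with a random public `β`. [cite: ChenQuantumLattice2024, §3.5.9 pp. 35–37] -/
noncomputable def priorValue (U : Finset (Fin (n + 1))) (bk b : Fin (n + 1) → ℤ)
    (μ : (Fin (n + 1) → ZQ Q) → ℝ) : ℝ :=
  (∑ β : U → ZQ Q, Finset.univ.sup' Finset.univ_nonempty (priorFiber n p₁ Q U bk b μ β))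
    / ((∑ s, μ s) * (((Q : ℕ+) : ℕ) : ℝ) ^ U.card)

/-- **T15 (probability form, upper bound).**  Under ANY prior `μ ≥ 0`, `Σμ > 0`, on the secret shift (datum
and offset shift uniform), every POVM on the Step-9 register guesses the datum with probability at most
the prior value `V_μ`. [cite: ChenQuantumLattice2024, §3.5.9 pp. 35–37; NielsenChuang2010, §2.2.6 p. 90] -/
theorem datum_prior_success_prob_le_value (hP : Odd ((p₁ * Q : ℕ+) : ℕ)) (U : Finset (Fin (n + 1)))
    (bk b v' : Fin (n + 1) → ℤ)
    (hb : ∀ i ∈ U, ((p₁ : ℕ) : ℤ) ∣ b i) (hbkU : ∀ i ∈ U, ((p₁ : ℕ) : ℤ) ∣ bk i)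
    (hbk : ∀ i, i ∉ U → bk i = b i) (hunit : ∃ i₀, i₀ ∉ U ∧ IsUnit ((bk i₀ : ℤ) : ZQ Q))
    (μ : (Fin (n + 1) → ZQ Q) → ℝ) (hμ : 0 < ∑ s, μ s)
    (E : POVM (Fin (n + 1) → ZN D p₁ Q) (ZQ Q)) :
    (∑ a, ∑ sc, (μ sc.1 : ℂ) * E.weight (datumKet n D p₁ Q U bk b v' a sc) a).re
        / (∑ a : ZQ Q, ∑ sc : (Fin (n + 1) → ZQ Q) × (Fin (n + 1) → ZQ Q),
            (μ sc.1 : ℂ) * (star (datumKet n D p₁ Q U bk b v' a sc)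
              ⬝ᵥ datumKet n D p₁ Q U bk b v' a sc)).re
      ≤ priorValue n p₁ Q U bk b μ := by
  have hW := datum_prior_weight_le n D p₁ Q hP U bk b v' hb hbkU hbk hunit μ
    (fun β => Finset.univ.sup' Finset.univ_nonempty (priorFiber n p₁ Q U bk b μ β))
    (fun β g => Finset.le_sup' (priorFiber n p₁ Q U bk b μ β) (Finset.mem_univ g)) E
  have hQ : (0 : ℝ) < ((Q : ℕ+) : ℕ) := by exact_mod_cast PNat.pos Q
  have hP' : (0 : ℝ) < ((p₁ * Q : ℕ+) : ℕ) := by exact_mod_cast PNat.pos _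
  have hN : (0 : ℝ) < ((D * D * (p₁ * Q) : ℕ+) : ℕ) := by exact_mod_cast PNat.pos _
  have hB : 0 < blockConst n D p₁ Q U := blockConst_pos n D p₁ Q U
  rw [datum_prior_totalWeight n D p₁ Q hP]
  unfold priorValue
  rw [div_le_div_iff₀ (mul_pos (mul_pos (mul_pos hQ (pow_pos hQ _)) hμ) (mul_pos hP' (pow_pos hN _)))
    (mul_pos hμ (pow_pos hQ _))]
  calc (∑ a, ∑ sc, (μ sc.1 : ℂ) * E.weight (datumKet n D p₁ Q U bk b v' a sc) a).re
          * ((∑ s, μ s) * (((Q : ℕ+) : ℕ) : ℝ) ^ U.card)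
        ≤ ((((Q : ℕ+) : ℕ) : ℝ) ^ (n + 1) * (((Q : ℕ+) : ℕ) : ℝ) * blockConst n D p₁ Q U
            * ∑ β : U → ZQ Q, Finset.univ.sup' Finset.univ_nonempty (priorFiber n p₁ Q U bk b μ β))
          * ((∑ s, μ s) * (((Q : ℕ+) : ℕ) : ℝ) ^ U.card) :=
          mul_le_mul_of_nonneg_right hW (mul_pos hμ (pow_pos hQ _)).le
    _ = (∑ β : U → ZQ Q, Finset.univ.sup' Finset.univ_nonempty (priorFiber n p₁ Q U bk b μ β))
          * ((((Q : ℕ+) : ℕ) : ℝ) * (((Q : ℕ+) : ℕ) : ℝ) ^ (n + 1) * (∑ s, μ s)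
            * ((((p₁ * Q : ℕ+) : ℕ) : ℝ) * (((D * D * (p₁ * Q) : ℕ+) : ℕ) : ℝ) ^ (n + 1))) := by
          rw [← blockConst_mul_pow n D p₁ Q U]
          ring

/-! ### 4. Attainment: the block read-out with the Bayes guess -/

/-- The ROUTING of the prior read-out: on seeing `(β, r)`, output `r + ĝ(β)` (the Bayes guess `ĝ(β)` of
the twist shift on the block `β`). [folklore] -/
noncomputable def shiftRouting (U : Finset (Fin (n + 1))) (ĝ : (U → ZQ Q) → ZQ Q) (a : ZQ Q)
    (j : (U → ZQ Q) × ZQ Q) : ℝ :=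
  if a = j.2 + ĝ j.1 then 1 else 0

/-- `κ ≥ 0`. [folklore] -/
theorem shiftRouting_nonneg (U : Finset (Fin (n + 1))) (ĝ : (U → ZQ Q) → ZQ Q) (a : ZQ Q)
    (j : (U → ZQ Q) × ZQ Q) : 0 ≤ shiftRouting n Q U ĝ a j := by
  unfold shiftRouting
  split_ifs
  · exact zero_le_one
  · exact le_rfl

/-- `Σ_a κ(a | j) = 1`. [folklore] -/
theorem sum_shiftRouting (U : Finset (Fin (n + 1))) (ĝ : (U → ZQ Q) → ZQ Q) (j : (U → ZQ Q) × ZQ Q) :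
    ∑ a, shiftRouting n Q U ĝ a j = 1 := by
  unfold shiftRouting
  rw [Finset.sum_ite_eq' Finset.univ (j.2 + ĝ j.1), if_pos (Finset.mem_univ _)]

/-- **The prior datum read-out**: the routed POVM of the block-twisted kets with the Bayes routing — "read
`ū = β`; discriminate the `Q` orthogonal twists `w_{β,r}` on the block; output `r + ĝ(β)`".  Built from
PUBLIC data `(U, bk, v′)` and the guess table `ĝ` only.
[cite: ChenQuantumLattice2024, §3.5.9 pp. 35–37; NielsenChuang2010, Box 2.3 p. 87] -/
noncomputable def datumReadoutPrior (hP : Odd ((p₁ * Q : ℕ+) : ℕ)) (U : Finset (Fin (n + 1)))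
    (bk v' : Fin (n + 1) → ℤ) (hunit : ∃ i₀, i₀ ∉ U ∧ IsUnit ((bk i₀ : ℤ) : ZQ Q))
    (ĝ : (U → ZQ Q) → ZQ Q) : POVM (Fin (n + 1) → ZN D p₁ Q) (ZQ Q) :=
  POVM.ofRouting (blockKet n D p₁ Q U bk v') (blockConst n D p₁ Q U) (blockConst_pos n D p₁ Q U)
    (blockKet_orth n D p₁ Q hP U bk v' hunit) (shiftRouting n Q U ĝ) (shiftRouting_nonneg n Q U ĝ)
    (sum_shiftRouting n Q U ĝ)

/-- **Weights of the prior read-out on every member.**  On the member `(a, (s, c))` the prior read-out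
outputs `a` with Born weight exactly `c·#{β : 2τ(β, s) = ĝ(β)}` — it is right on exactly the blocks where
the Bayes guess hits the member's twist shift. [cite: ChenQuantumLattice2024, §3.5.9 pp. 35–37, eq. (12) p. 17] -/
theorem datumReadoutPrior_weight (hP : Odd ((p₁ * Q : ℕ+) : ℕ)) (U : Finset (Fin (n + 1)))
    (bk b v' : Fin (n + 1) → ℤ)
    (hb : ∀ i ∈ U, ((p₁ : ℕ) : ℤ) ∣ b i) (hbkU : ∀ i ∈ U, ((p₁ : ℕ) : ℤ) ∣ bk i)
    (hbk : ∀ i, i ∉ U → bk i = b i) (hunit : ∃ i₀, i₀ ∉ U ∧ IsUnit ((bk i₀ : ℤ) : ZQ Q))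
    (ĝ : (U → ZQ Q) → ZQ Q) (a : ZQ Q) (sc : (Fin (n + 1) → ZQ Q) × (Fin (n + 1) → ZQ Q)) :
    (datumReadoutPrior n D p₁ Q hP U bk v' hunit ĝ).weight (datumKet n D p₁ Q U bk b v' a sc) a
      = ((blockConst n D p₁ Q U : ℝ) : ℂ)
        * ((Finset.univ.filter fun β : U → ZQ Q => 2 * twistShift n p₁ Q U bk b β sc.1 = ĝ β).card : ℂ) := by
  classical
  -- the selected indices `(β, a − 2τ(β))`, one per block
  have hsel : (Finset.univ.filter fun j : (U → ZQ Q) × ZQ Q =>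
        j.2 = a - 2 * twistShift n p₁ Q U bk b j.1 sc.1).card = Fintype.card (U → ZQ Q) := by
    rw [← Fintype.card_subtype]
    exact Fintype.card_congr
      { toFun := fun j => j.1.1
        invFun := fun β => ⟨(β, a - 2 * twistShift n p₁ Q U bk b β sc.1), rfl⟩
        left_inv := fun j => Subtype.ext (Prod.ext rfl j.2.symm)
        right_inv := fun β => rfl }
  have hQm : ((Fintype.card (U → ZQ Q) : ℕ) : ℂ) = ((((Q : ℕ+) : ℕ) : ℂ)) ^ U.card := by
    rw [Fintype.card_fun, ZMod.card, Fintype.card_coe, Nat.cast_pow]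
  have hBc : ((blockConst n D p₁ Q U : ℝ) : ℂ) * ((((Q : ℕ+) : ℕ) : ℂ)) ^ U.card
      = ((((p₁ * Q : ℕ+) : ℕ) : ℂ)) * ((((D * D * (p₁ * Q) : ℕ+) : ℕ) : ℂ)) ^ (n + 1) := by
    exact_mod_cast congrArg (fun x : ℝ => (x : ℂ)) (blockConst_mul_pow n D p₁ Q U)
  have hnorm : star (datumKet n D p₁ Q U bk b v' a sc) ⬝ᵥ datumKet n D p₁ Q U bk b v' a sc
      = ((blockConst n D p₁ Q U : ℝ) : ℂ)
        * ((Finset.univ.filter fun j : (U → ZQ Q) × ZQ Q =>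
            j.2 = a - 2 * twistShift n p₁ Q U bk b j.1 sc.1).card : ℂ) := by
    rw [datumKet_normSq n D p₁ Q hP, hsel, hQm, hBc]
    push_cast
    ring
  unfold datumReadoutPrior
  rw [POVM.ofRouting_weight_of_aligned (blockConst_pos n D p₁ Q U) (blockKet_orth n D p₁ Q hP U bk v' hunit)
      (shiftRouting n Q U ĝ) (shiftRouting_nonneg n Q U ĝ) (sum_shiftRouting n Q U ĝ)
      (fun j : (U → ZQ Q) × ZQ Q => j.2 = a - 2 * twistShift n p₁ Q U bk b j.1 sc.1)
      (fun j => (ZMod.stdAddChar (blockPhase n p₁ Q U bk b j.1 sc) : ℂ))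
      (fun j => starRingEnd_stdAddChar_mul_self Q _)
      (fun j => blockKet_dot_datumKet n D p₁ Q hP U bk b v' hb hbkU hbk hunit a sc j) hnorm]
  congr 1
  -- the selected coefficients: `κ(a | β, a − 2τ) = [2τ(β,s) = ĝ β]`
  rw [Finset.sum_filter, Fintype.sum_prod_type, Finset.card_filter]
  push_cast
  refine Finset.sum_congr rfl fun β _ => ?_
  rw [Finset.sum_ite_eq' Finset.univ (a - 2 * twistShift n p₁ Q U bk b β sc.1), if_pos (Finset.mem_univ _)]
  unfold shiftRouting
  dsimp only
  by_cases h : 2 * twistShift n p₁ Q U bk b β sc.1 = ĝ β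
  · rw [if_pos h, if_pos (by rw [← h]; ring), Complex.ofReal_one]
  · rw [if_neg h, if_neg (fun h' => h (by linear_combination h')), Complex.ofReal_zero]

/-- **The `μ`-weighted weight of the prior read-out**: `Q^{n+2}·c·Σ_β F_μ(β, ĝ(β))`.
[cite: ChenQuantumLattice2024, §3.5.9 pp. 35–37, eq. (12) p. 17] -/
theorem datum_prior_weight_attained (hP : Odd ((p₁ * Q : ℕ+) : ℕ)) (U : Finset (Fin (n + 1)))
    (bk b v' : Fin (n + 1) → ℤ)
    (hb : ∀ i ∈ U, ((p₁ : ℕ) : ℤ) ∣ b i) (hbkU : ∀ i ∈ U, ((p₁ : ℕ) : ℤ) ∣ bk i)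
    (hbk : ∀ i, i ∉ U → bk i = b i) (hunit : ∃ i₀, i₀ ∉ U ∧ IsUnit ((bk i₀ : ℤ) : ZQ Q))
    (μ : (Fin (n + 1) → ZQ Q) → ℝ) (ĝ : (U → ZQ Q) → ZQ Q) :
    (∑ a, ∑ sc, (μ sc.1 : ℂ)
        * (datumReadoutPrior n D p₁ Q hP U bk v' hunit ĝ).weight (datumKet n D p₁ Q U bk b v' a sc) a).re
      = (((Q : ℕ+) : ℕ) : ℝ) ^ (n + 1) * (((Q : ℕ+) : ℕ) : ℝ) * blockConst n D p₁ Q U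
        * ∑ β, priorFiber n p₁ Q U bk b μ β (ĝ β) := by
  classical
  obtain ⟨F, hF⟩ : ∃ F : (Fin (n + 1) → ZQ Q) → ℝ, ∀ s, F s = μ s * (blockConst n D p₁ Q U
      * ((Finset.univ.filter fun β : U → ZQ Q => 2 * twistShift n p₁ Q U bk b β s = ĝ β).card : ℝ)) :=
    ⟨_, fun s => rfl⟩
  have hC : ∀ (a : ZQ Q) (sc : (Fin (n + 1) → ZQ Q) × (Fin (n + 1) → ZQ Q)),
      (μ sc.1 : ℂ)
          * (datumReadoutPrior n D p₁ Q hP U bk v' hunit ĝ).weight (datumKet n D p₁ Q U bk b v' a sc) a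
        = ((F sc.1 : ℝ) : ℂ) := by
    intro a sc
    rw [datumReadoutPrior_weight n D p₁ Q hP U bk b v' hb hbkU hbk hunit ĝ, hF]
    push_cast
    ring
  simp_rw [hC, ← Complex.ofReal_sum]
  rw [Complex.ofReal_re, Finset.sum_const, Finset.card_univ, ZMod.card, nsmul_eq_mul, Fintype.sum_prod_type]
  dsimp only
  simp only [Finset.sum_const, Finset.card_univ, Fintype.card_fun, ZMod.card, Fintype.card_fin, nsmul_eq_mul]
  have hswap : ∑ β, priorFiber n p₁ Q U bk b μ β (ĝ β)
      = ∑ s, μ s * ((Finset.univ.filter fun β : U → ZQ Q =>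
          2 * twistShift n p₁ Q U bk b β s = ĝ β).card : ℝ) := by
    unfold priorFiber
    simp_rw [Finset.sum_filter, Finset.card_filter]
    push_cast
    rw [Finset.sum_comm]
    refine Finset.sum_congr rfl fun s _ => ?_
    rw [Finset.mul_sum]
    refine Finset.sum_congr rfl fun β _ => ?_
    split_ifs
    · rw [mul_one]
    · rw [mul_zero]
  rw [hswap]
  simp only [Finset.mul_sum]
  refine Finset.sum_congr rfl fun s _ => ?_
  rw [hF]
  push_cast
  ring

/-! ### 5. The exact optimum under every prior -/

/-- **T15 (attainment).**  With the Bayes guess `ĝ(β) ∈ argmax_g F_μ(β, g)` the prior read-out guesses the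
datum with probability EXACTLY `V_μ`. [cite: ChenQuantumLattice2024, §3.5.9 pp. 35–37; NielsenChuang2010, Box 2.3 p. 87] -/
theorem datum_prior_success_prob_eq_value (hP : Odd ((p₁ * Q : ℕ+) : ℕ)) (U : Finset (Fin (n + 1)))
    (bk b v' : Fin (n + 1) → ℤ)
    (hb : ∀ i ∈ U, ((p₁ : ℕ) : ℤ) ∣ b i) (hbkU : ∀ i ∈ U, ((p₁ : ℕ) : ℤ) ∣ bk i)
    (hbk : ∀ i, i ∉ U → bk i = b i) (hunit : ∃ i₀, i₀ ∉ U ∧ IsUnit ((bk i₀ : ℤ) : ZQ Q))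
    (μ : (Fin (n + 1) → ZQ Q) → ℝ) (hμ : 0 < ∑ s, μ s) :
    ∃ ĝ : (U → ZQ Q) → ZQ Q,
      (∑ a, ∑ sc, (μ sc.1 : ℂ)
          * (datumReadoutPrior n D p₁ Q hP U bk v' hunit ĝ).weight (datumKet n D p₁ Q U bk b v' a sc) a).re
          / (∑ a : ZQ Q, ∑ sc : (Fin (n + 1) → ZQ Q) × (Fin (n + 1) → ZQ Q),
              (μ sc.1 : ℂ) * (star (datumKet n D p₁ Q U bk b v' a sc)
                ⬝ᵥ datumKet n D p₁ Q U bk b v' a sc)).re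
        = priorValue n p₁ Q U bk b μ := by
  classical
  have hex : ∀ β : U → ZQ Q, ∃ g : ZQ Q,
      Finset.univ.sup' Finset.univ_nonempty (priorFiber n p₁ Q U bk b μ β) = priorFiber n p₁ Q U bk b μ β g := by
    intro β
    obtain ⟨g, -, hg⟩ := Finset.exists_mem_eq_sup' Finset.univ_nonempty (priorFiber n p₁ Q U bk b μ β)
    exact ⟨g, hg⟩
  choose ĝ hĝ using hex
  refine ⟨ĝ, ?_⟩
  have hQ : (0 : ℝ) < ((Q : ℕ+) : ℕ) := by exact_mod_cast PNat.pos Q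
  have hP' : (0 : ℝ) < ((p₁ * Q : ℕ+) : ℕ) := by exact_mod_cast PNat.pos _
  have hN : (0 : ℝ) < ((D * D * (p₁ * Q) : ℕ+) : ℕ) := by exact_mod_cast PNat.pos _
  rw [datum_prior_weight_attained n D p₁ Q hP U bk b v' hb hbkU hbk hunit,
    datum_prior_totalWeight n D p₁ Q hP]
  unfold priorValue
  simp_rw [hĝ]
  rw [div_eq_div_iff (mul_pos (mul_pos (mul_pos hQ (pow_pos hQ _)) hμ) (mul_pos hP' (pow_pos hN _))).ne'
    (mul_pos hμ (pow_pos hQ _)).ne', ← blockConst_mul_pow n D p₁ Q U]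
  ring

/-- **T15: the exact optimum under EVERY prior on the unknown coordinates.**  For every weight `μ ≥ 0`,
`Σμ > 0`, on the secret shifts (the datum `a` and the offset shift `c` uniform — they ARE uniform and
independent of the secret, Steps 1–8), the greatest `μ`-average probability, over ALL POVMs on the Step-9
register `ℤ_N^{n+1}`, of outputting the datum is EXACTLY
`V_μ = E_{β ∈ ℤ_Q^U} max_g Pr_μ[Σ_{i∈U}((b_i−bk_i)/p₁ + 2s_i)β_i = g]`: the register is worth precisely ONE
noiseless random inner product of the unknown coordinates.  `μ ≡ 1` is T13 (`priorValue_one_eq_datumValue`);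
a point mass gives `1` (`priorValue_single`). [cite: ChenQuantumLattice2024, §3.5.9 pp. 35–37, eq. (12) p. 17;
NielsenChuang2010, §2.2.6 p. 90, Box 2.3 p. 87] -/
theorem datum_prior_isGreatest (hP : Odd ((p₁ * Q : ℕ+) : ℕ)) (U : Finset (Fin (n + 1)))
    (bk b v' : Fin (n + 1) → ℤ)
    (hb : ∀ i ∈ U, ((p₁ : ℕ) : ℤ) ∣ b i) (hbkU : ∀ i ∈ U, ((p₁ : ℕ) : ℤ) ∣ bk i)
    (hbk : ∀ i, i ∉ U → bk i = b i) (hunit : ∃ i₀, i₀ ∉ U ∧ IsUnit ((bk i₀ : ℤ) : ZQ Q))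
    (μ : (Fin (n + 1) → ZQ Q) → ℝ) (hμ : 0 < ∑ s, μ s) :
    IsGreatest (Set.range fun E : POVM (Fin (n + 1) → ZN D p₁ Q) (ZQ Q) =>
        (∑ a, ∑ sc, (μ sc.1 : ℂ) * E.weight (datumKet n D p₁ Q U bk b v' a sc) a).re
          / (∑ a : ZQ Q, ∑ sc : (Fin (n + 1) → ZQ Q) × (Fin (n + 1) → ZQ Q),
              (μ sc.1 : ℂ) * (star (datumKet n D p₁ Q U bk b v' a sc)
                ⬝ᵥ datumKet n D p₁ Q U bk b v' a sc)).re)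
      (priorValue n p₁ Q U bk b μ) := by
  obtain ⟨ĝ, hĝ⟩ := datum_prior_success_prob_eq_value n D p₁ Q hP U bk b v' hb hbkU hbk hunit μ hμ
  refine ⟨⟨datumReadoutPrior n D p₁ Q hP U bk v' hunit ĝ, hĝ⟩, ?_⟩
  rintro _ ⟨E, rfl⟩
  exact datum_prior_success_prob_le_value n D p₁ Q hP U bk b v' hb hbkU hbk hunit μ hμ E

/-! ### 6. Special priors: no prior (T13) and a known secret -/

/-- **T15 at the uniform prior is T13**: `V_{μ ≡ 1} = V(Q, #U)` (both are the optimum of the same quantity).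
[cite: ChenQuantumLattice2024, §3.5.9 pp. 35–37] -/
theorem priorValue_one_eq_datumValue (hP : Odd ((p₁ * Q : ℕ+) : ℕ)) (U : Finset (Fin (n + 1)))
    (bk b : Fin (n + 1) → ℤ)
    (hb : ∀ i ∈ U, ((p₁ : ℕ) : ℤ) ∣ b i) (hbkU : ∀ i ∈ U, ((p₁ : ℕ) : ℤ) ∣ bk i)
    (hbk : ∀ i, i ∉ U → bk i = b i) (hunit : ∃ i₀, i₀ ∉ U ∧ IsUnit ((bk i₀ : ℤ) : ZQ Q)) :
    priorValue n p₁ Q U bk b (fun _ => 1) = datumValue Q U := by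
  have hμ : (0 : ℝ) < ∑ _s : Fin (n + 1) → ZQ Q, (1 : ℝ) := by
    rw [Finset.sum_const, Finset.card_univ, nsmul_eq_mul, mul_one]
    exact_mod_cast Fintype.card_pos
  have h1 := datum_prior_isGreatest n 1 p₁ Q hP U bk b 0 hb hbkU hbk hunit (fun _ => (1 : ℝ)) hμ
  have h2 := datum_success_prob_isGreatest n 1 p₁ Q hP U bk b 0 hb hbkU hbk hunit
  simp only [Complex.ofReal_one, one_mul] at h1
  exact h1.unique h2

/-- **A known secret reads the datum with certainty**: for a point-mass prior `V_μ = 1` (on every block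
the twist shift is known; T4-sharpness at the level of the datum). [cite: ChenQuantumLattice2024, §3.5.9 pp. 35–37] -/
theorem priorValue_single (U : Finset (Fin (n + 1))) (bk b : Fin (n + 1) → ℤ) (s₀ : Fin (n + 1) → ZQ Q) :
    priorValue n p₁ Q U bk b (fun s => if s = s₀ then 1 else 0) = 1 := by
  classical
  have hQ : (0 : ℝ) < ((Q : ℕ+) : ℕ) := by exact_mod_cast PNat.pos Q
  have hfib : ∀ (β : U → ZQ Q) (g : ZQ Q),
      priorFiber n p₁ Q U bk b (fun s => if s = s₀ then 1 else 0) β g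
        = if 2 * twistShift n p₁ Q U bk b β s₀ = g then 1 else 0 := by
    intro β g
    unfold priorFiber
    rw [Finset.sum_ite_eq' (Finset.univ.filter _) s₀]
    simp only [Finset.mem_filter, Finset.mem_univ, true_and]
  have hsup : ∀ β : U → ZQ Q, Finset.univ.sup' Finset.univ_nonempty
      (priorFiber n p₁ Q U bk b (fun s => if s = s₀ then 1 else 0) β) = 1 := by
    intro β
    refine le_antisymm (Finset.sup'_le _ _ fun g _ => ?_)
      (le_trans ?_ (Finset.le_sup' _ (Finset.mem_univ (2 * twistShift n p₁ Q U bk b β s₀))))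
    · rw [hfib]
      split_ifs
      · exact le_rfl
      · exact zero_le_one
    · rw [hfib, if_pos rfl]
  unfold priorValue
  simp_rw [hsup]
  rw [Finset.sum_const, Finset.card_univ, Finset.sum_ite_eq' Finset.univ s₀, if_pos (Finset.mem_univ _),
    Fintype.card_fun, ZMod.card, Fintype.card_coe, nsmul_eq_mul, mul_one, one_mul, Nat.cast_pow,
    div_self (pow_ne_zero _ hQ.ne')]

/-- **Universal range of the prior value**: `1/Q ≤ V_μ ≤ 1` for `μ ≥ 0`, `Σμ > 0` (pigeonhole on each block;
each fibre is at most the total mass). [folklore] -/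
theorem priorValue_le_one (U : Finset (Fin (n + 1))) (bk b : Fin (n + 1) → ℤ)
    (μ : (Fin (n + 1) → ZQ Q) → ℝ) (hμ0 : ∀ s, 0 ≤ μ s) (hμ : 0 < ∑ s, μ s) :
    priorValue n p₁ Q U bk b μ ≤ 1 := by
  classical
  have hQ : (0 : ℝ) < ((Q : ℕ+) : ℕ) := by exact_mod_cast PNat.pos Q
  unfold priorValue
  rw [div_le_one (mul_pos hμ (pow_pos hQ _))]
  have hle : ∀ β : U → ZQ Q, Finset.univ.sup' Finset.univ_nonempty (priorFiber n p₁ Q U bk b μ β)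
      ≤ ∑ s, μ s := by
    intro β
    refine Finset.sup'_le _ _ fun g _ => ?_
    unfold priorFiber
    exact Finset.sum_le_sum_of_subset_of_nonneg (Finset.filter_subset _ _) fun s _ _ => hμ0 s
  refine (Finset.sum_le_sum fun β _ => hle β).trans (le_of_eq ?_)
  rw [Finset.sum_const, Finset.card_univ, Fintype.card_fun, ZMod.card, Fintype.card_coe, nsmul_eq_mul,
    Nat.cast_pow, mul_comm]

end Readout

end Literature.Computability.Cryptography.Chen2024

/-! ### The `Steps` rendering: T15 for every admissible shape -/

namespace Literature.Computability.Cryptography.Chen2024.Shape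

open scoped BigOperators ComplexOrder
open Matrix

variable (S : Shape)

/-- **T15 for every admissible shape.**  Let `U ∌ 0` be the unknown coordinates, `bk` any PUBLIC vector
agreeing with `S.b` off `U` and `≡ 0 (mod p₁)` on `U`, `v′` any representative of the offset class, and `μ`
ANY weight (`Σμ > 0`) on the secret shifts — the observer's prior on the unknown coordinates (LWE secret and
noise entries).  Then the greatest `μ`-average probability over ALL measurements of the Step-9 register of
outputting the datum is EXACTLY the prior value `V_μ`: the mean over a uniformly random `β ∈ ℤ_Q^U` of the
best `μ`-probability of one value of the inner product `Σ_{i∈U}((b_i−bk_i)/p₁ + 2s_i)β_i (mod Q)`.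
[cite: ChenQuantumLattice2024, §3.5.9 pp. 35–37, eq. (12) p. 17, Cond. C.3–C.5 p. 18] -/
theorem datum_privacy_prior (h : S.Admissible) (U : Finset (Fin (S.n + 1)))
    (hU : (0 : Fin (S.n + 1)) ∉ U) (bk : Fin (S.n + 1) → ℤ)
    (hbkU : ∀ i ∈ U, ((S.p₁ : ℕ) : ℤ) ∣ bk i) (hbk : ∀ i, i ∉ U → bk i = S.b i)
    (v' : Fin (S.n + 1) → ℤ) (μ : (Fin (S.n + 1) → ZQ S.Q) → ℝ) (hμ : 0 < ∑ s, μ s) :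
    IsGreatest (Set.range fun E : POVM (Fin (S.n + 1) → ZN S.D S.p₁ S.Q) (ZQ S.Q) =>
        (∑ a, ∑ sc, (μ sc.1 : ℂ) * E.weight (datumKet S.n S.D S.p₁ S.Q U bk S.b v' a sc) a).re
          / (∑ a : ZQ S.Q, ∑ sc : (Fin (S.n + 1) → ZQ S.Q) × (Fin (S.n + 1) → ZQ S.Q),
              (μ sc.1 : ℂ) * (star (datumKet S.n S.D S.p₁ S.Q U bk S.b v' a sc)
                ⬝ᵥ datumKet S.n S.D S.p₁ S.Q U bk S.b v' a sc)).re)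
      (priorValue S.n S.p₁ S.Q U bk S.b μ) :=
  datum_prior_isGreatest S.n S.D S.p₁ S.Q h.odd_P U bk S.b v' (h.p₁_dvd_of_mem hU) hbkU hbk
    (h.exists_unit_coord hU hbk) μ hμ

/-- **The two extreme priors for every admissible shape**: no prior gives T13's `V(Q, #U)`, a known secret
gives `1`. [cite: ChenQuantumLattice2024, §3.5.9 pp. 35–37, Cond. C.3 p. 18] -/
theorem datum_privacy_prior_extremes (h : S.Admissible) (U : Finset (Fin (S.n + 1)))
    (hU : (0 : Fin (S.n + 1)) ∉ U) (bk : Fin (S.n + 1) → ℤ)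
    (hbkU : ∀ i ∈ U, ((S.p₁ : ℕ) : ℤ) ∣ bk i) (hbk : ∀ i, i ∉ U → bk i = S.b i)
    (s₀ : Fin (S.n + 1) → ZQ S.Q) :
    priorValue S.n S.p₁ S.Q U bk S.b (fun _ => 1) = datumValue S.Q U
      ∧ priorValue S.n S.p₁ S.Q U bk S.b (fun s => if s = s₀ then 1 else 0) = 1 :=
  ⟨priorValue_one_eq_datumValue S.n S.p₁ S.Q h.odd_P U bk S.b (h.p₁_dvd_of_mem hU) hbkU hbk
      (h.exists_unit_coord hU hbk),
    priorValue_single S.n S.p₁ S.Q U bk S.b s₀⟩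

end Literature.Computability.Cryptography.Chen2024.Shape
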